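import Summits.Ventures.PercRepro.C041RcPortCountAll

/-!
# The singleton-attachment family is a sub-family of the rc family (p6, gen 24)

Setting of `C041RcPortCount` and of the g23 chain (`C041SkeletonCountSum` / `C041SkeletonCountAll`).  A source of the
singleton-attachment family (`Sing S`: a vertex with a blue terminal edge has no blue bare edge) has singleton
attached zones, which are trivially rc: `isRcSrc_of_isSrc` (`IsSrc O S → IsRcSrc O S`) and `rcSrcAll` contains
`singSrc` (`singSrc_subset_rcSrcAll`).  So THEOREM R for the rc family (`sum_goodDegree_nonneg_rc`) is the statement
on the larger family, and the g23 theorem `sum_goodDegree_nonneg_sing` is its restriction to singleton zones.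
-/

namespace PercRepro

namespace MultiGraph

open Finset ZonePort

variable {V E : Type*} {G : MultiGraph V E}

section Sing

variable [Fintype V] (a b c : V)

/-- Under the singleton condition the zone of a vertex with a blue terminal edge is the singleton. -/
theorem zone_eq_singleton_of_sing {O S : Config E} (hagree : G.AgreeBare a b O S) (hsing : G.Sing a b S) {u : V}
    (hu : G.BlueTo a S u ∨ G.BlueTo b S u) : G.zone a b O u = {u} := by
  have hblue : ∃ e, (G.Joins e u a ∨ G.Joins e u b) ∧ S e = false := by
    rcases hu with ⟨e, hj, hS⟩ | ⟨e, hj, hS⟩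
    · exact ⟨e, Or.inl hj, hS⟩
    · exact ⟨e, Or.inr hj, hS⟩
  ext w
  rw [mem_zone, Finset.mem_singleton]
  constructor
  · intro hw
    induction hw with
    | refl => rfl
    | @tail x y _ hxy ih =>
      exfalso
      obtain ⟨e, he, hO, hj⟩ := hxy
      rw [ih] at hj
      have hS : S e = true := hsing u hblue e he (EdgeAt.of_joins_left hj)
      rw [hagree e he] at hS
      rw [hO] at hS
      exact Bool.noConfusion hS
  · intro hw
    rw [hw]
    exact BlueBareConn.refl a b O u

/-- A singleton zone is rc. -/
theorem rc_of_zone_eq_singleton {O : Config E} {u : V} (h : G.zone a b O u = {u}) : G.Rc a b O u := by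
  intro x hx y hy
  rw [h, Finset.mem_singleton] at hx hy
  rw [hx, hy]

/-- **A source of the singleton-attachment family is a source of the rc family.** -/
theorem isRcSrc_of_isSrc {O S : Config E} (hS : G.IsSrc a b c O S) : G.IsRcSrc a b c O S := by
  obtain ⟨hagree, hsing, hDA⟩ := hS
  exact ⟨hagree, fun u hu => rc_of_zone_eq_singleton a b (zone_eq_singleton_of_sing a b hagree hsing hu), hDA⟩

variable [Fintype E] [DecidableEq E]

open Classical in
/-- The singleton-family sources lie among the rc-family sources. -/
theorem singSrc_subset_rcSrcAll : G.singSrc a b c ⊆ G.rcSrcAll a b c := by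
  intro S hS
  unfold singSrc at hS
  unfold rcSrcAll
  rw [mem_filter] at hS ⊢
  refine ⟨mem_univ _, isRcSrc_of_isSrc a b c ⟨agreeBare_bareOf a b S, hS.2.1, hS.2.2⟩⟩

end Sing

end MultiGraph

end PercRepro
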